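/-
Copyright (c) 2026 the pub-hodgecm-mathlib formalisation cell (harness21).  Prover seat hodgecm-mathlib-K2E3-p28 (g4) (S6 hand under dealer R90-C14-plan (g2)),
card (G2) «TYPE-(2) DISCHARGE», FILE 1b = the REDUCTION of the ramified type-(2) elliptic κ-identity at every displacement `m` to its two unit-level anchors
(census `K2/K2E3-p28/g4/G2-DISCHARGE-CENSUS.md` 368559be56a7517e, 2026-09-05T03:22Z).  THEOREMS ONLY (no `def`, no `instance`, no notation, no named-fact
hypothesis, no `sorry`); lane `--supports stmt-HodgeConjecture-24833 --as helper` (count-neutral helper).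
-/
import Summits.HodgeConjecture.HodgeConjecture.Theorems.R90S6EllipticIdentityTypeTwoShells   -- FILE 1a (this seat): §1 `sum_xiHCoeff_mul_shell_eq_closed_of_firstShell_eq`, §2 `ncard_selfDual_displaced_zero_eq_natCard_fixedBy_three`, `ncard_selfDual_displaced_cast_eq_of_natCard_fixedBy`, §3 `exists_firstShell_of_ncard_fixed_eq`; brings ★ 2a, ★ H2-NUMBERS, `xiHCoeff`
import HarnessLib

/-!
# R90 · S6 — row E1.3.5.2.6, card (G2) FILE 1b: THE RAMIFIED TYPE-(2) ELLIPTIC κ-IDENTITY AT EVERY DISPLACEMENT `m` FROM ITS TWO UNIT-LEVEL ANCHORS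
# (`Theorems/R90S6EllipticIdentityTypeTwoReduction.lean`)

Cell `hodgecm-mathlib`, crux H413 (`stmt-HodgeConjecture-24833`), route of record `HCCMUnconditional`; programme R90-TF, section S6 (base `R90-C14`, dealer
R90-C14-plan (g2)), seat K2E3-p28 (g4); card **(G2) «TYPE-(2) DISCHARGE»** of the RECORD target (E2) = typ1 sheet v2.3 `4c174fca74d7a58a` :468
`delta_mul_kappaDiff_ncard_displaced_typeTwo_eq_sum_xiHCoeff_mul_ncard_displaced_two` ([BR₁] Thm. 1 = Rogawski Prop. 4.9.1 (b) for the ramified anisotropic torus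
`T ≃ E¹ × Res M¹`, read on the two Bruhat–Tits trees; Flicker 1998 Theorem 18 at `m = 0`).

THE MATHEMATICS (letters of FILE 1a).  A type-(2) stable class in `U₃` holds two classes `γ₁` (κ = +) and `γ₂` (κ = −); its endoscopic class in `H = U(1,1) × U(1)` is
ONE class `δ = t_H` (Rogawski Lemma 3.6.1) whose `U(1,1)`-part lies in the ramified torus `M¹`: it fixes an EDGE MIDPOINT of `X₂` and exactly the radius-`N` tube about
it, so `F₀(δ) = F₁(δ) = P` (`P = Σ_{k ≤ N} q^k`, ★ HF2 `ncard_fixed_selfDual_eq_sum_of_typeTwoCorner` ∕ `ncard_fixed_modular_eq_sum_of_typeTwoCorner` — taken here as the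
VALUE letters `hF0 hF1`, `1 ≤ P`).  By FILE 1a both sides of (E2) are then closed forms: H side `Σ_{k≤m} ξ_{m,k} S₂(δ,k) = q^{2m−3}(q³P − P + 1)` (`m` even) ∕
`q^{2(m−1)}(qP − q − P)` (`m` odd), `= P` at `m = 0`; G side per class `S′(γ,k) = q^{2k−3}(q³V₀ − V₁ + 1)` ∕ `q^{2(k−1)}(qV₁ − V₀ + 1)`, `S′(γ,0) = V₀`.  HEAD: if
**(U0₂)** `Δ·(V₀(γ₁) − V₀(γ₂)) = P` and **(U1₂)** `Δ·(V₁(γ₁) − V₁(γ₂)) = P − 1`, then for EVERY `m` `Δ·(S′(γ₁,m) − S′(γ₂,m)) = Σ_{k≤m} ξ_{m,k}·S₂(δ,k)` — the (E2) identity;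
`m = 0` IS (U0₂), `m = 1` is (U1₂) given (U0₂), and every higher `m` costs nothing (`linear_combination` of the two anchors with the §1 closed values; no `hD`, no type swap —
the edge-midpoint symmetry `N₀ = N₁` does their work).  (U0₂) in values is Flicker's Theorem 18 (`Φ(t) − Φ(t′) = (−q)^n Φ_H`, `Δ = (−q)^{−n}`: ★ `Flicker1998.flicker_theorem18n`
with ★ a₀ and ★ (G2-ODD) A); (U1₂) is Theorem 18 one level down (★ (R2) and its odd twin).  The second theorem is the edition whose binders are a sublist of the RECORD
head's v2.3 binders (+ `P hP hF0 hF1 hU0 hU1`) and whose conclusion is its conclusion BYTES VERBATIM (`Δ := (−q)^{log|(u−A)² − C²ρ|}`).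
HONEST LABEL: a REDUCTION over ★ files — (E2) :468 for all `m` follows from the two anchors and the two ★ HF2 fixed counts; it proves no printed global statement by
itself, discharges no citation and is count-neutral until E1.3.5.2 ∕ E1.3.9 consume it.  HC_CM is proved only modulo the 7 printed citations (2 remaining named inputs:
hLiu418 = stmt-HodgeConjecture-24832, h413 = stmt-HodgeConjecture-24833) until rung 0 closes.

## References
* [Rogawski1990] J. D. Rogawski, *Automorphic Representations of Unitary Groups in Three Variables*, Ann. of Math. Stud. 123 (1990), §4.9 Prop. 4.9.1 (b) pp. 54–55;
  §3.6 Lemma 3.6.1 p. 28 (`𝓔_H(T) ↪ 𝓔_G(T)` of index two for the type-(2) torus).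
* [Flicker1998UnitaryFL] Y. Z. Flicker, *Elementary proof of the fundamental lemma for a unitary group*, Canad. J. Math. 50 (1998), Props. 16–17 pp. 96–97, Theorem 18 p. 97.
* [Macdonald1971] I. G. Macdonald, *Spherical functions on a group of p-adic type* (1971), Ch. V §3.  [Serre1980Trees] J.-P. Serre, *Trees* (1980), I.6.4 Prop. 24, II.1.1.
* [LabesseLanglands1979] J.-P. Labesse, R. P. Langlands, *L-indistinguishability for SL(2)*, Canad. J. Math. 31 (1979), §§2–3.  [Kottwitz1988] R. E. Kottwitz, *Tamagawa numbers* (1988), §2.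
-/

set_option autoImplicit false
-- the mandated namespace repeats the single-problem summit's segment (`HodgeConjecture.HodgeConjecture`)
set_option linter.dupNamespace false

noncomputable section

open MulAction SimpleGraph Finset
open scoped WithZero Matrix MatrixGroups
open Literature.NumberTheory.Automorphic Literature.NumberTheory.Automorphic.HermitianLattice Literature.NumberTheory.Automorphic.UnitaryGroup

namespace Summit.HodgeConjecture.HodgeConjecture.R90.S6


/-! ## §4 HEADS: the type-(2) identity at every `m` from the anchors (U0₂), (U1₂) -/

section Heads

open scoped Valued

variable {K : Type} [Field K] [Valued K ℤᵐ⁰] [ValuativeRel K] [(Valued.v : Valuation K ℤᵐ⁰).Compatible] {σ : K →+* K} {ϖ : K}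

/-- **(G2) THE RAMIFIED TYPE-(2) ELLIPTIC κ-IDENTITY AT EVERY DISPLACEMENT FROM ITS TWO UNIT-LEVEL ANCHORS (general scalar `Δ`).**  Unramified datum `hd`, residual letters
(`#𝓀 = q²`, `σ̄ = Frob_q`), `g₁ = diag(1,1,ϖ)`; two elements `γ₁, γ₂ ∈ U₃` with the RECORD head's finiteness letters (`Fix` on `U₃ ⧸ K₀`, `U₃ ⧸ K₁` finite, finite `K₀`-orbit of
powers); ONE `δ ∈ U₂` on the locally finite `(q+1)`-regular `X₂` fixing `P ≥ 1` self-dual and `P` `ϖ`-modular vertices (★ HF2's two counts as letters).  IF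
(U0₂) `Δ·(V₀(γ₁) − V₀(γ₂)) = P` and (U1₂) `Δ·(V₁(γ₁) − V₁(γ₂)) = P − 1` (`V₀ = #Fix(U₃ ⧸ K₀)`, `V₁ = #Fix(U₃ ⧸ K₁)`), THEN for every `m`
`Δ·(S′(γ₁, m) − S′(γ₂, m)) = Σ_{k ≤ m} xiHCoeff q m k · S₂(δ, k)` — §2 (G side per class) against §3 + §1 (H side, one class, `N₀ = N₁`); `m = 0` is (U0₂) itself.
With `Δ = (−q)^{−n}`, `κ = (+, −)` this is `Δ‴·Φ^κ(γ, φ_m) = Φ^{st}(γ_H, ξ̂_H φ_m)` for the torus `T ≃ E¹ × Res M¹`.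
[cite: Rogawski1990, §4.9 Prop. 4.9.1 (b) pp. 54–55; §3.6 Lemma 3.6.1 p. 28] [cite: Flicker1998UnitaryFL, Theorem 18 p. 97] [cite: Macdonald1971, Ch. V §3] [cite: Serre1980Trees, I.6.4 Prop. 24] -/
theorem kappaDiff_ncard_displaced_typeTwo_eq_sum_xiHCoeff_of_unitLevels (hd : HermitianLattice.UnramifiedLocalConjDatum σ ϖ)
    (hσO : ∀ x : 𝒪[K], σ x ∈ 𝒪[K]) (σk : 𝓀[K] →+* 𝓀[K])
    (hσk : ∀ x : 𝒪[K], IsLocalRing.residue 𝒪[K] ⟨σ x, hσO x⟩ = σk (IsLocalRing.residue 𝒪[K] x))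
    [Fintype 𝓀[K]] {q : ℕ} (hq : Fintype.card 𝓀[K] = q ^ 2) (hfrob : ∀ y, σk y = y ^ q)
    (g₁ : GL (Fin 3) K) (hg₁ : (g₁ : Matrix (Fin 3) (Fin 3) K) = Matrix.diagonal ![(1 : K), 1, ϖ])
    (γ₁ γ₂ : ↥(unitaryGroupOfForm σ ((StdForm.antidiagonal 3).over K)))
    (hfin₀₁ : (fixedBy (↥(unitaryGroupOfForm σ ((StdForm.antidiagonal 3).over K)) ⧸
      (glInt 3 K).subgroupOf (unitaryGroupOfForm σ ((StdForm.antidiagonal 3).over K))) γ₁).Finite)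
    (hfin₁₁ : (fixedBy (↥(unitaryGroupOfForm σ ((StdForm.antidiagonal 3).over K)) ⧸
      ((glInt 3 K).map (MulAut.conj g₁).toMonoidHom).subgroupOf (unitaryGroupOfForm σ ((StdForm.antidiagonal 3).over K))) γ₁).Finite)
    (horb₁ : (Set.range fun n : ℕ => ((γ₁ ^ n : ↥(unitaryGroupOfForm σ ((StdForm.antidiagonal 3).over K))) :
      ↥(unitaryGroupOfForm σ ((StdForm.antidiagonal 3).over K)) ⧸ (glInt 3 K).subgroupOf (unitaryGroupOfForm σ ((StdForm.antidiagonal 3).over K)))).Finite)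
    (hfin₀₂ : (fixedBy (↥(unitaryGroupOfForm σ ((StdForm.antidiagonal 3).over K)) ⧸
      (glInt 3 K).subgroupOf (unitaryGroupOfForm σ ((StdForm.antidiagonal 3).over K))) γ₂).Finite)
    (hfin₁₂ : (fixedBy (↥(unitaryGroupOfForm σ ((StdForm.antidiagonal 3).over K)) ⧸
      ((glInt 3 K).map (MulAut.conj g₁).toMonoidHom).subgroupOf (unitaryGroupOfForm σ ((StdForm.antidiagonal 3).over K))) γ₂).Finite)
    (horb₂ : (Set.range fun n : ℕ => ((γ₂ ^ n : ↥(unitaryGroupOfForm σ ((StdForm.antidiagonal 3).over K))) :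
      ↥(unitaryGroupOfForm σ ((StdForm.antidiagonal 3).over K)) ⧸ (glInt 3 K).subgroupOf (unitaryGroupOfForm σ ((StdForm.antidiagonal 3).over K)))).Finite)
    (δ : ↥(unitaryGroupOfForm σ ((StdForm.antidiagonal 2).over K)))
    (hloc : ∀ v, ((HermitianLatticeTree.latticeTree σ ϖ ((StdForm.antidiagonal 2).over K)).neighborSet v).Finite)
    (hreg : ∀ v, ((HermitianLatticeTree.latticeTree σ ϖ ((StdForm.antidiagonal 2).over K)).neighborSet v).ncard = q + 1)
    {P : ℕ} (hP : 1 ≤ P)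
    (hF0 : {x : {M : Submodule (ValuativeRel.valuation K).integer (Fin 2 → K) // HermitianLatticeTree.IsSpecialLattice σ ϖ ((StdForm.antidiagonal 2).over K) M} |
      HermitianLatticeTree.IsSelfDualLattice σ ((StdForm.antidiagonal 2).over K) x.1 ∧
        HermitianLatticeTree.latticeTreeIso σ ϖ ((StdForm.antidiagonal 2).over K) δ x = x}.ncard = P)
    (hF1 : {x : {M : Submodule (ValuativeRel.valuation K).integer (Fin 2 → K) // HermitianLatticeTree.IsSpecialLattice σ ϖ ((StdForm.antidiagonal 2).over K) M} |
      HermitianLatticeTree.IsModularLattice σ ϖ ((StdForm.antidiagonal 2).over K) x.1 ∧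
        HermitianLatticeTree.latticeTreeIso σ ϖ ((StdForm.antidiagonal 2).over K) δ x = x}.ncard = P)
    (Δ : ℂ)
    (hU0 : Δ * ((Nat.card (fixedBy (↥(unitaryGroupOfForm σ ((StdForm.antidiagonal 3).over K)) ⧸
          (glInt 3 K).subgroupOf (unitaryGroupOfForm σ ((StdForm.antidiagonal 3).over K))) γ₁) : ℂ) -
        (Nat.card (fixedBy (↥(unitaryGroupOfForm σ ((StdForm.antidiagonal 3).over K)) ⧸
          (glInt 3 K).subgroupOf (unitaryGroupOfForm σ ((StdForm.antidiagonal 3).over K))) γ₂) : ℂ)) = P)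
    (hU1 : Δ * ((Nat.card (fixedBy (↥(unitaryGroupOfForm σ ((StdForm.antidiagonal 3).over K)) ⧸
          ((glInt 3 K).map (MulAut.conj g₁).toMonoidHom).subgroupOf (unitaryGroupOfForm σ ((StdForm.antidiagonal 3).over K))) γ₁) : ℂ) -
        (Nat.card (fixedBy (↥(unitaryGroupOfForm σ ((StdForm.antidiagonal 3).over K)) ⧸
          ((glInt 3 K).map (MulAut.conj g₁).toMonoidHom).subgroupOf (unitaryGroupOfForm σ ((StdForm.antidiagonal 3).over K))) γ₂) : ℂ)) = (P : ℂ) - 1)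
    (m : ℕ) :
    Δ * (({x : {M : Submodule 𝒪[K] (Fin 3 → K) // UnitaryLatticeTree.IsVertex σ ϖ ((StdForm.antidiagonal 3).over K) M} |
              UnitaryLatticeTree.IsSelfDualLattice σ ϖ ((StdForm.antidiagonal 3).over K) x.1 ∧
                (UnitaryLatticeTree.latticeGraph σ ϖ ((StdForm.antidiagonal 3).over K)).dist x
                  (UnitaryLatticeTree.latticeGraphPerm σ ϖ ((StdForm.antidiagonal 3).over K) γ₁ x) = 2 * m}.ncard : ℂ) -
          ({x : {M : Submodule 𝒪[K] (Fin 3 → K) // UnitaryLatticeTree.IsVertex σ ϖ ((StdForm.antidiagonal 3).over K) M} |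
              UnitaryLatticeTree.IsSelfDualLattice σ ϖ ((StdForm.antidiagonal 3).over K) x.1 ∧
                (UnitaryLatticeTree.latticeGraph σ ϖ ((StdForm.antidiagonal 3).over K)).dist x
                  (UnitaryLatticeTree.latticeGraphPerm σ ϖ ((StdForm.antidiagonal 3).over K) γ₂ x) = 2 * m}.ncard : ℂ)) =
      ∑ k ∈ Finset.range (m + 1), xiHCoeff q m k *
          ({x : {M : Submodule (ValuativeRel.valuation K).integer (Fin 2 → K) // HermitianLatticeTree.IsSpecialLattice σ ϖ ((StdForm.antidiagonal 2).over K) M} |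
              HermitianLatticeTree.IsSelfDualLattice σ ((StdForm.antidiagonal 2).over K) x.1 ∧
                (HermitianLatticeTree.latticeTree σ ϖ ((StdForm.antidiagonal 2).over K)).dist x
                  (HermitianLatticeTree.latticeTreeIso σ ϖ ((StdForm.antidiagonal 2).over K) δ x) = 2 * k}.ncard : ℂ) := by
  classical
  -- H side: the common first shell `M`, `M + P = qP + 1`, and the zero shell `S₂(δ,0) = P`
  obtain ⟨M, hMP, hS⟩ := exists_firstShell_of_ncard_fixed_eq hd δ hloc hreg hP hF0 hF1
  have h0 : {x : {M : Submodule (ValuativeRel.valuation K).integer (Fin 2 → K) // HermitianLatticeTree.IsSpecialLattice σ ϖ ((StdForm.antidiagonal 2).over K) M} |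
      HermitianLatticeTree.IsSelfDualLattice σ ((StdForm.antidiagonal 2).over K) x.1 ∧
        (HermitianLatticeTree.latticeTree σ ϖ ((StdForm.antidiagonal 2).over K)).dist x
          (HermitianLatticeTree.latticeTreeIso σ ϖ ((StdForm.antidiagonal 2).over K) δ x) = 2 * 0}.ncard = P := by
    rw [ncard_selfDual_displaced_zero_eq_ncard_fixed_two hd δ]; exact hF0
  rcases Nat.eq_zero_or_pos m with rfl | hm
  · -- `m = 0`: (U0₂) itself
    rw [Nat.zero_add, Finset.sum_range_one, xiHCoeff_self, pow_zero, one_mul, h0,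
      ncard_selfDual_displaced_zero_eq_natCard_fixedBy_three hd γ₁, ncard_selfDual_displaced_zero_eq_natCard_fixedBy_three hd γ₂]
    exact hU0
  · -- `m ≥ 1`: closed forms on both sides
    rw [ncard_selfDual_displaced_cast_eq_of_natCard_fixedBy hd hσO σk hσk hq hfrob g₁ hg₁ γ₁ hfin₀₁ hfin₁₁ horb₁ m hm,
      ncard_selfDual_displaced_cast_eq_of_natCard_fixedBy hd hσO σk hσk hq hfrob g₁ hg₁ γ₂ hfin₀₂ hfin₁₂ horb₂ m hm,
      sum_xiHCoeff_mul_shell_eq_closed_of_firstShell_eq q m hm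
        (fun k => {x : {M : Submodule (ValuativeRel.valuation K).integer (Fin 2 → K) //
            HermitianLatticeTree.IsSpecialLattice σ ϖ ((StdForm.antidiagonal 2).over K) M} |
          HermitianLatticeTree.IsSelfDualLattice σ ((StdForm.antidiagonal 2).over K) x.1 ∧
            (HermitianLatticeTree.latticeTree σ ϖ ((StdForm.antidiagonal 2).over K)).dist x
              (HermitianLatticeTree.latticeTreeIso σ ϖ ((StdForm.antidiagonal 2).over K) δ x) = 2 * k}.ncard) P M hMP h0 hS]
    by_cases he : Even m
    · simp only [if_pos he]
      linear_combination (q : ℂ) ^ (2 * m - 3) * ((q : ℂ) ^ 3 * hU0 - hU1)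
    · simp only [if_neg he]
      linear_combination (q : ℂ) ^ (2 * (m - 1)) * ((q : ℂ) * hU1 - hU0)

/-- **(G2) THE RECORD EDITION — conclusion of typ1 v2.3 :468 `delta_mul_kappaDiff_ncard_displaced_typeTwo_eq_sum_xiHCoeff_mul_ncard_displaced_two` BYTES VERBATIM,
binders a sublist of its binders** (non-dyadic datum `hd : LocalConjDatum`, residual letters, the type-(2) letters `A C ρ u` of the scalar `Δ = (−q)^{log|(u−A)² − C²ρ|}`,
`γ₁ γ₂ δ`, `g₁ hg₁`, the six appended finiteness letters, `hloc hreg`) plus the two ★ HF2 counts as value letters (`P`, `hP`, `hF0`, `hF1`) and the two anchors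
(U0₂) `Δ·(V₀(γ₁) − V₀(γ₂)) = P`, (U1₂) `Δ·(V₁(γ₁) − V₁(γ₂)) = P − 1`: then (E2) holds at every displacement `m`.  (`P = Σ_{k ≤ N} q^k` by ★ HF2; (U0₂) = Flicker's Theorem 18
with `Δ = (−q)^{−n}`; (U1₂) = Theorem 18 at `(n−2, N−1)`.)
[cite: Rogawski1990, §4.9 Prop. 4.9.1 (b) pp. 54–55; §3.6 Lemma 3.6.1 p. 28] [cite: Flicker1998UnitaryFL, Theorem 18 p. 97; Props. 16–17 pp. 96–97] [cite: LabesseLanglands1979, §§2–3] -/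
theorem delta_mul_kappaDiff_ncard_displaced_typeTwo_eq_sum_xiHCoeff_mul_ncard_displaced_two_of_unitLevels
    (hd : HermitianLattice.LocalConjDatum σ ϖ)
    (hσO : ∀ x : 𝒪[K], σ x ∈ 𝒪[K]) (σk : 𝓀[K] →+* 𝓀[K])
    (hσk : ∀ x : 𝒪[K], IsLocalRing.residue 𝒪[K] ⟨σ x, hσO x⟩ = σk (IsLocalRing.residue 𝒪[K] x))
    [Fintype 𝓀[K]] {q : ℕ} (hq : Fintype.card 𝓀[K] = q ^ 2) (hfrob : ∀ y, σk y = y ^ q)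
    {A C ρ u : K}
    (γ₁ : unitaryGroupOfForm σ ((StdForm.antidiagonal 3).over K))
    (γ₂ : unitaryGroupOfForm σ ((StdForm.antidiagonal 3).over K))
    (δ : unitaryGroupOfForm σ ((StdForm.antidiagonal 2).over K))
    (g₁ : GL (Fin 3) K) (hg₁ : (g₁ : Matrix (Fin 3) (Fin 3) K) = Matrix.diagonal ![(1 : K), 1, ϖ])
    (hfin₀₁ : (fixedBy (↥(unitaryGroupOfForm σ ((StdForm.antidiagonal 3).over K)) ⧸
      (glInt 3 K).subgroupOf (unitaryGroupOfForm σ ((StdForm.antidiagonal 3).over K))) γ₁).Finite)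
    (hfin₁₁ : (fixedBy (↥(unitaryGroupOfForm σ ((StdForm.antidiagonal 3).over K)) ⧸
      ((glInt 3 K).map (MulAut.conj g₁).toMonoidHom).subgroupOf (unitaryGroupOfForm σ ((StdForm.antidiagonal 3).over K))) γ₁).Finite)
    (horb₁ : (Set.range fun n : ℕ => ((γ₁ ^ n : ↥(unitaryGroupOfForm σ ((StdForm.antidiagonal 3).over K))) :
      ↥(unitaryGroupOfForm σ ((StdForm.antidiagonal 3).over K)) ⧸ (glInt 3 K).subgroupOf (unitaryGroupOfForm σ ((StdForm.antidiagonal 3).over K)))).Finite)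
    (hfin₀₂ : (fixedBy (↥(unitaryGroupOfForm σ ((StdForm.antidiagonal 3).over K)) ⧸
      (glInt 3 K).subgroupOf (unitaryGroupOfForm σ ((StdForm.antidiagonal 3).over K))) γ₂).Finite)
    (hfin₁₂ : (fixedBy (↥(unitaryGroupOfForm σ ((StdForm.antidiagonal 3).over K)) ⧸
      ((glInt 3 K).map (MulAut.conj g₁).toMonoidHom).subgroupOf (unitaryGroupOfForm σ ((StdForm.antidiagonal 3).over K))) γ₂).Finite)
    (horb₂ : (Set.range fun n : ℕ => ((γ₂ ^ n : ↥(unitaryGroupOfForm σ ((StdForm.antidiagonal 3).over K))) :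
      ↥(unitaryGroupOfForm σ ((StdForm.antidiagonal 3).over K)) ⧸ (glInt 3 K).subgroupOf (unitaryGroupOfForm σ ((StdForm.antidiagonal 3).over K)))).Finite)
    (hloc : ∀ v, ((HermitianLatticeTree.latticeTree σ ϖ ((StdForm.antidiagonal 2).over K)).neighborSet v).Finite)
    (hreg : ∀ v, ((HermitianLatticeTree.latticeTree σ ϖ ((StdForm.antidiagonal 2).over K)).neighborSet v).ncard = q + 1)
    {P : ℕ} (hP : 1 ≤ P)
    (hF0 : {x : {M : Submodule (ValuativeRel.valuation K).integer (Fin 2 → K) // HermitianLatticeTree.IsSpecialLattice σ ϖ ((StdForm.antidiagonal 2).over K) M} |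
      HermitianLatticeTree.IsSelfDualLattice σ ((StdForm.antidiagonal 2).over K) x.1 ∧
        HermitianLatticeTree.latticeTreeIso σ ϖ ((StdForm.antidiagonal 2).over K) δ x = x}.ncard = P)
    (hF1 : {x : {M : Submodule (ValuativeRel.valuation K).integer (Fin 2 → K) // HermitianLatticeTree.IsSpecialLattice σ ϖ ((StdForm.antidiagonal 2).over K) M} |
      HermitianLatticeTree.IsModularLattice σ ϖ ((StdForm.antidiagonal 2).over K) x.1 ∧
        HermitianLatticeTree.latticeTreeIso σ ϖ ((StdForm.antidiagonal 2).over K) δ x = x}.ncard = P)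
    (hU0 : (-(q : ℂ)) ^ WithZero.log (Valued.v ((u - A) ^ 2 - C ^ 2 * ρ)) *
        ((Nat.card (fixedBy (↥(unitaryGroupOfForm σ ((StdForm.antidiagonal 3).over K)) ⧸
            (glInt 3 K).subgroupOf (unitaryGroupOfForm σ ((StdForm.antidiagonal 3).over K))) γ₁) : ℂ) -
          (Nat.card (fixedBy (↥(unitaryGroupOfForm σ ((StdForm.antidiagonal 3).over K)) ⧸
            (glInt 3 K).subgroupOf (unitaryGroupOfForm σ ((StdForm.antidiagonal 3).over K))) γ₂) : ℂ)) = P)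
    (hU1 : (-(q : ℂ)) ^ WithZero.log (Valued.v ((u - A) ^ 2 - C ^ 2 * ρ)) *
        ((Nat.card (fixedBy (↥(unitaryGroupOfForm σ ((StdForm.antidiagonal 3).over K)) ⧸
            ((glInt 3 K).map (MulAut.conj g₁).toMonoidHom).subgroupOf (unitaryGroupOfForm σ ((StdForm.antidiagonal 3).over K))) γ₁) : ℂ) -
          (Nat.card (fixedBy (↥(unitaryGroupOfForm σ ((StdForm.antidiagonal 3).over K)) ⧸
            ((glInt 3 K).map (MulAut.conj g₁).toMonoidHom).subgroupOf (unitaryGroupOfForm σ ((StdForm.antidiagonal 3).over K))) γ₂) : ℂ)) = (P : ℂ) - 1)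
    (m : ℕ) :
    (-(q : ℂ)) ^ WithZero.log (Valued.v ((u - A) ^ 2 - C ^ 2 * ρ)) *
        (({x : {M : Submodule 𝒪[K] (Fin 3 → K) // UnitaryLatticeTree.IsVertex σ ϖ ((StdForm.antidiagonal 3).over K) M} |
              UnitaryLatticeTree.IsSelfDualLattice σ ϖ ((StdForm.antidiagonal 3).over K) x.1 ∧
                (UnitaryLatticeTree.latticeGraph σ ϖ ((StdForm.antidiagonal 3).over K)).dist x
                  (UnitaryLatticeTree.latticeGraphPerm σ ϖ ((StdForm.antidiagonal 3).over K) γ₁ x) = 2 * m}.ncard : ℂ) -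
          ({x : {M : Submodule 𝒪[K] (Fin 3 → K) // UnitaryLatticeTree.IsVertex σ ϖ ((StdForm.antidiagonal 3).over K) M} |
              UnitaryLatticeTree.IsSelfDualLattice σ ϖ ((StdForm.antidiagonal 3).over K) x.1 ∧
                (UnitaryLatticeTree.latticeGraph σ ϖ ((StdForm.antidiagonal 3).over K)).dist x
                  (UnitaryLatticeTree.latticeGraphPerm σ ϖ ((StdForm.antidiagonal 3).over K) γ₂ x) = 2 * m}.ncard : ℂ)) =
      ∑ k ∈ Finset.range (m + 1), xiHCoeff q m k *
          ({x : {M : Submodule (ValuativeRel.valuation K).integer (Fin 2 → K) // HermitianLatticeTree.IsSpecialLattice σ ϖ ((StdForm.antidiagonal 2).over K) M} |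
              HermitianLatticeTree.IsSelfDualLattice σ ((StdForm.antidiagonal 2).over K) x.1 ∧
                (HermitianLatticeTree.latticeTree σ ϖ ((StdForm.antidiagonal 2).over K)).dist x
                  (HermitianLatticeTree.latticeTreeIso σ ϖ ((StdForm.antidiagonal 2).over K) δ x) = 2 * k}.ncard : ℂ) :=
  kappaDiff_ncard_displaced_typeTwo_eq_sum_xiHCoeff_of_unitLevels hd.toUnramified hσO σk hσk hq hfrob g₁ hg₁ γ₁ γ₂ hfin₀₁ hfin₁₁ horb₁ hfin₀₂ hfin₁₂ horb₂
    δ hloc hreg hP hF0 hF1 _ hU0 hU1 m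

end Heads

end Summit.HodgeConjecture.HodgeConjecture.R90.S6

end
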